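import Summits.BirchSwinnertonDyer.BirchSwinnertonDyer.Theorems.BiquadraticEisensteinDescentEisensteinDivisibilityCMInertBadFlatAtOneStubEa
import Summits.BirchSwinnertonDyer.BirchSwinnertonDyer.Theorems.BiquadraticEisensteinDescentEisensteinDivisibilityCMInertBadFlatAtOneStubE2
import Summits.BirchSwinnertonDyer.BirchSwinnertonDyer.Theorems.BiquadraticEisensteinDescentEisensteinDivisibilityCMInertBadFlatAtOneStubE0
import Summits.BirchSwinnertonDyer.BirchSwinnertonDyer.Theorems.BiquadraticEisensteinDescentEisensteinDivisibilityCMInertBadStubE3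
import HarnessLib

set_option linter.dupNamespace false -- `Summit.BirchSwinnertonDyer.BirchSwinnertonDyer.Theorems.…` (summit = sub)
set_option autoImplicit false

/-!
# Crux (E♭°) `EisensteinDivisibilityCMInertBadFlatAtOne` (stmt-BirchSwinnertonDyer-20452), line `birth`:
# the COMPOSITION MODULO THE HEART — the crux's conclusion, at every datum carrying the two binders the rev-8
# statement lacks (`Odd d_K′`, (Irr)), from the research stub `stub_E1B` ALONE plus three refereed named facts

Route `BiquadraticEisensteinDescent` (cell `pub/bsd-wall`, lead-prover seat `bsd-wall-bed-p1`, g2; skeleton of record v3,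
stubs `stub_E0` / `stub_E1B` / `stub_E2`, landed `stub_E3` p508737, proved `stub_Ea`). The three landed helpers

* `…FlatAtOneStubE0.exists_isBDPLFunction_of_thmA_anyLevel_of_bdp2013` (p519641) — an `R₀`-frame exists, from (A∞) Hsieh
  Thm. A at any level and (R) BDP13 central-value reciprocity, for `K′` of odd discriminant;
* `…FlatAtOneStubE2.not_C_dvd_of_isBDPLFunction_of_thmB_anyLevel` (p519061) — `p ∤ L` for every `R₀`-frame, from (B)
  Hsieh Thm. B at any level and (Irr);
* `…FlatAtOneStubEa.span_map_eq_span_of_isBDPLFunction_of_isBDPLFunctionInt` (p518297) — an `R₀`-frame and the given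
  ♭-frame generate the same ideal of `𝓞_{ℂ_p}⟦T⟧`;

together with the landed prime avoidance `…StubE3.stub_E3` leave EXACTLY ONE open input, the registered research stub
`stub_E1B` (family-B Eisenstein divisibility up to a power of `p`: Hsieh JAMS 2014 Thm. 2 with hypothesis (2) —
"`ψ` unramified at `Σ_p^c`" [doi:10.1090/s0894-0347-2014-00786-4, p. 3] — violated by `ψ_L`; not in print). This file
records that fact as ONE kernel-checked implication:

* `flatAtOne_of_stubE1B_of_facts` — `(A∞) → (R) → (B) → stub_E1B → ∀ <the binders of the crux VERBATIM, with
  Odd (discr K′) inserted after the Heegner binder and (Irr) after it>, <the crux's conclusion VERBATIM>`.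

So the rev-8 item is, as typed, short of exactly two binders (`Odd (NumberField.discr K′)`; (Irr): every framed mod-`p`
representation of `W/K′` absolutely irreducible) and three published antecedents ((A∞) = the route's support item
`HsiehAnyLevelInput` 20456; (R) `bertoliniDarmonPrasanna2013_centralValue_reciprocity`; (B)
`Hsieh2014.thmB_exists_isHsiehLFunction_coeff_norm_eq_one_unrPeriod_anyLevel`) for its proof to reduce to `stub_E1B`.
The hypothesis `hE1B` is the REGISTERED stub's statement verbatim (a `∀`-proposition taken as a hypothesis, not a
definition); nothing is asserted about it.

THEOREMS ONLY (no definition, no named fact, no `sorry`); imports no `Theses` module (the conclusion is spelled out, not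
named); CONDITIONAL. Supports, does not close, stmt-BirchSwinnertonDyer-20452.

References: [Hsieh2014] Thm. A, Thm. B (Doc. Math. 19 p. 712); [Hsieh2014JAMS] Thm. 2 p. 3 (hypothesis (2));
[BertoliniDarmonPrasanna2013] Thm. 5.5; [Castella2018] Thm. 3.1 (arXiv:1704.06608 p. 9).
-/

noncomputable section

open scoped Classical NumberField

open PowerSeries NumberField IsDedekindDomain Field WeierstrassCurve
  Literature.NumberTheory.EllipticCurves Literature.NumberTheory.EllipticCurves.ModularForms
  Literature.NumberTheory.EllipticCurves.Rank1Residual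
  Literature.NumberTheory.GaloisRepresentations Literature.NumberTheory.Automorphic
  Literature.NumberTheory.EllipticCurves.Hsieh2014
  Summit.BirchSwinnertonDyer.Rank1Residual.X11b
  Summit.BirchSwinnertonDyer.Rank1Residual.X11b.AcSelmer Summit.BirchSwinnertonDyer.Rank1Residual.X11b.Halves
  Summit.BirchSwinnertonDyer.BirchSwinnertonDyer.Theorems.BiquadraticEisensteinDescentEisensteinDivisibilityCMInertBadFlatAtOneStubEa
  Summit.BirchSwinnertonDyer.BirchSwinnertonDyer.Theorems.BiquadraticEisensteinDescentEisensteinDivisibilityCMInertBadFlatAtOneStubE2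
  Summit.BirchSwinnertonDyer.BirchSwinnertonDyer.Theorems.BiquadraticEisensteinDescentEisensteinDivisibilityCMInertBadFlatAtOneStubE0
  Summit.BirchSwinnertonDyer.BirchSwinnertonDyer.Theorems.BiquadraticEisensteinDescentEisensteinDivisibilityCMInertBadStubE3

namespace Summit.BirchSwinnertonDyer.BirchSwinnertonDyer.Theorems.BiquadraticEisensteinDescentEisensteinDivisibilityCMInertBadFlatAtOneOfFacts

/-- **Crux (E♭°) modulo its heart.** From (A∞) Hsieh Thm. A at any level, (R) BDP13 central-value reciprocity, (B) Hsieh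
Thm. B at any level and the registered research stub `stub_E1B` (verbatim, as the hypothesis `hE1B`): at every datum of
the crux `EisensteinDivisibilityCMInertBadFlatAtOne` — binders VERBATIM — that ALSO satisfies `Odd (discr K′)` and (Irr),
the crux's conclusion holds: the constant terms of `Ch_Λ(X_ac(W/K′), strict at 𝔭′)` lie in `Q(𝟙)·𝓞_{ℂ_p}`. Chain:
`R₀`-frame `L₁` (StubE0 helper) → `p^m·Ch ⊆ (L₁)` (`hE1B`) → `p ∤ L₁` (StubE2 helper) → `Ch·R₀⟦T⟧ ⊆ (L₁)` (`stub_E3`)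
→ `(L₁)·𝓞_{ℂ_p}⟦T⟧ = (Q)` (StubEa helper) → constant terms. CONDITIONAL on (A∞), (R), (B) and on `hE1B` (OPEN).
[cite: Hsieh2014, Thm. A and Thm. B p. 712 (Doc. Math. 19)] [cite: BertoliniDarmonPrasanna2013, Thm. 5.5 (p. 60)]
[cite: Castella2018, Thm. 3.1 (arXiv:1704.06608 p. 9)] -/
theorem flatAtOne_of_stubE1B_of_facts
    (hA : thmA_exists_isHsiehLFunction_unrPeriod_anyLevel)
    (hR : bertoliniDarmonPrasanna2013_centralValue_reciprocity)
    (hB : thmB_exists_isHsiehLFunction_coeff_norm_eq_one_unrPeriod_anyLevel)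
    (hE1B : ∀ (W : WeierstrassCurve ℚ) [W.IsElliptic] [W.IsGloballyMinimal] (p : ℕ) [Fact p.Prime]
      [NeZero (W.conductorNorm ℤ)] (K : Type) [Field K] [NumberField K],
      W.HasCM → W.analyticRank = 1 → 5 ≤ p → CMInert W p → ¬ Good W p →
      IsImaginaryQuadratic K → SatisfiesHeegnerHypothesis (W.conductorNorm ℤ) K →
      4 < (NumberField.discr K).natAbs →
      (∀ (M : Type) [Field M] [NumberField M], Module.finrank ℚ M = 4 →
        (∃ x : M, x ^ 2 = ((cmFieldDiscrOfJ W.j : ℤ) : M)) → (∃ y : M, y ^ 2 = ((NumberField.discr K : ℤ) : M)) →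
        ¬ p ∣ NumberField.classNumber M) →
      (W.quadraticTwist (NumberField.discr K : ℚ)).entireLFunction 1 ≠ 0 →
      ∀ (κ : ZpExtension K p), κ.IsAnticyclotomic →
        ∀ (γ : Field.absoluteGaloisGroup K) [Fact (κ.IsTopGenerator γ)]
          (𝔭 : HeightOneSpectrum (𝓞 K)), ((p : ℕ) : 𝓞 K) ∈ 𝔭.asIdeal →
          𝔭.asIdeal.ramificationIdx (𝓞 ℚ) = 1 → 𝔭.asIdeal.inertiaDeg (𝓞 ℚ) = 1 →
          ∀ (f : CuspForm (CongruenceSubgroup.Gamma0 (W.conductorNorm ℤ)) 2), IsNewformOf W f →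
            ∀ (ι' : PadicAlgCl p ≃+* ℂ),
              (∀ (w : InfinitePlace K) (k : 𝓞 K), k ∈ 𝔭.asIdeal ↔ ‖ι'.symm (w.embedding (k : K))‖ < 1) →
              ∀ (ΩK : ℂ) (Ωp : (unrIntegers p)ˣ) (L : UnrSeries p), ΩK ≠ 0 →
                IsBDPLFunction ι' 𝔭 κ γ f ΩK ((Ωp : unrIntegers p) : ℂ_[p]) L →
                  ∀ (𝔭' : HeightOneSpectrum (𝓞 K)), ((p : ℕ) : 𝓞 K) ∈ 𝔭'.asIdeal → 𝔭' ≠ 𝔭 →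
                  ∃ m : ℕ, ∀ x ∈ (XAc.charIdeal (W.baseChange K) p κ 𝔭' ∅ γ).map (PowerSeries.map (toUnr p)),
                    (PowerSeries.C ((p : ℕ) : unrIntegers p) : UnrSeries p) ^ m * x ∈ Ideal.span {L}) :
  ∀ (W : WeierstrassCurve ℚ) [W.IsElliptic] [W.IsGloballyMinimal] (p : ℕ) [Fact p.Prime]
    [NeZero (W.conductorNorm ℤ)] (K : Type) [Field K] [NumberField K],
    W.HasCM → W.analyticRank = 1 → 5 ≤ p → CMInert W p → ¬ Good W p →
    IsImaginaryQuadratic K → SatisfiesHeegnerHypothesis (W.conductorNorm ℤ) K →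
    Odd (NumberField.discr K) →
    (∀ ρ : ModPGaloisRep K (ZMod p) 2, (W.baseChange K).IsTorsionGaloisRep p ρ →
      FramedRep.IsAbsolutelyIrreducible ρ) →
    4 < (NumberField.discr K).natAbs →
    (∀ (L : Type) [Field L] [NumberField L], Module.finrank ℚ L = 4 →
      (∃ x : L, x ^ 2 = ((cmFieldDiscrOfJ W.j : ℤ) : L)) → (∃ y : L, y ^ 2 = ((NumberField.discr K : ℤ) : L)) →
      ¬ p ∣ NumberField.classNumber L) →
    (W.quadraticTwist (NumberField.discr K : ℚ)).entireLFunction 1 ≠ 0 →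
    ∀ (κ : ZpExtension K p), κ.IsAnticyclotomic →
      ∀ (γ : Field.absoluteGaloisGroup K) [Fact (κ.IsTopGenerator γ)]
        (𝔭 : HeightOneSpectrum (𝓞 K)), ((p : ℕ) : 𝓞 K) ∈ 𝔭.asIdeal →
        𝔭.asIdeal.ramificationIdx (𝓞 ℚ) = 1 → 𝔭.asIdeal.inertiaDeg (𝓞 ℚ) = 1 →
        ∀ (𝔭' : HeightOneSpectrum (𝓞 K)), ((p : ℕ) : 𝓞 K) ∈ 𝔭'.asIdeal → 𝔭' ≠ 𝔭 →
        ∀ (f : CuspForm (CongruenceSubgroup.Gamma0 (W.conductorNorm ℤ)) 2), IsNewformOf W f →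
          ∀ (ι' : PadicAlgCl p ≃+* ℂ),
            (∀ (w : InfinitePlace K) (k : 𝓞 K), k ∈ 𝔭.asIdeal ↔ ‖ι'.symm (w.embedding (k : K))‖ < 1) →
            ∀ (ΩK : ℂ) (Ωp : (unrIntegers p)ˣ) (Q : PowerSeries (PadicComplexInt p)), ΩK ≠ 0 →
              R1.IsBDPLFunctionInt p ι' 𝔭 κ γ f ΩK ((Ωp : unrIntegers p) : (PadicComplex p)) Q →
                (XAc.charIdeal (W.baseChange K) p κ 𝔭' ∅ γ).map
                    ((R1.toCpInt p).comp (PowerSeries.constantCoeff : IwasawaAlgebra p →+* ℤ_[p])) ≤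
                  Ideal.span {PowerSeries.constantCoeff Q} := by
  intro W _ _ p _ _ K _ _ hCM hr hp5 hin hbad hK hHN hodd hIrr hd4 hadm hLt κ hκ γ hγ 𝔭 h𝔭 he hf 𝔭' h𝔭' hne f
    hfW ι' hι' ΩK Ωp Q hΩK hQ
  have hp2 : p ≠ 2 := by omega
  have hpN : p ∣ W.conductorNorm ℤ := (W.dvd_conductorNorm_iff_not_hasGoodReductionAtPrime p).mpr hbad
  -- (E0) an `R₀`-frame, from (A∞) + (R)
  obtain ⟨ΩK₁, Ωp₁, L₁, hΩK₁, hL₁⟩ := exists_isBDPLFunction_of_thmA_anyLevel_of_bdp2013 hA hR hp2 ι' W K 𝔭 κ γ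
    hfW rfl hpN hK hodd hHN h𝔭 he hf hι' hκ hγ.out
  -- (E1B) divisibility up to `p^m`, the OPEN input
  obtain ⟨m, hm⟩ := hE1B W p K hCM hr hp5 hin hbad hK hHN hd4 hadm hLt κ hκ γ 𝔭 h𝔭 he hf f hfW ι' hι' ΩK₁ Ωp₁ L₁
    hΩK₁ hL₁ 𝔭' h𝔭' hne
  -- (E2) `p ∤ L₁`, from (B) + (Irr); (E3) prime avoidance
  have hE2 := not_C_dvd_of_isBDPLFunction_of_thmB_anyLevel hB W hp2 hpN hfW hK hHN h𝔭 hι' hIrr hκ hγ.out hΩK₁ hL₁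
  have hB' : (XAc.charIdeal (W.baseChange K) p κ 𝔭' ∅ γ).map (PowerSeries.map (toUnr p)) ≤ Ideal.span {L₁} :=
    stub_E3 p _ L₁ m hE2 hm
  -- (Ea) the same ideal in `𝓞_{ℂ_p}⟦T⟧`
  have hspan : Ideal.span {PowerSeries.map (R1.unrToCpInt p) L₁} = Ideal.span {Q} :=
    span_map_eq_span_of_isBDPLFunction_of_isBDPLFunctionInt hp2 hK hκ hγ.out hΩK hΩK₁
      (coe_units_unrIntegers_ne_zero Ωp) (coe_units_unrIntegers_ne_zero Ωp₁) hQ hL₁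
  -- transfer to `𝓞_{ℂ_p}⟦T⟧` and take constant terms
  have hflat : (XAc.charIdeal (W.baseChange K) p κ 𝔭' ∅ γ).map (PowerSeries.map (R1.toCpInt p)) ≤
      Ideal.span {Q} := by
    rw [R1.map_toCpInt_eq_comp, ← Ideal.map_map, ← hspan]
    refine (Ideal.map_mono hB').trans ?_
    rw [Ideal.map_span, Set.image_singleton]
  have hcc : ∀ g : IwasawaAlgebra p, PowerSeries.constantCoeff (PowerSeries.map (R1.toCpInt p) g) =
      R1.toCpInt p (PowerSeries.constantCoeff g) := fun g ↦ by
    rw [← PowerSeries.coeff_zero_eq_constantCoeff_apply, PowerSeries.coeff_map,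
      PowerSeries.coeff_zero_eq_constantCoeff_apply]
  have hcomp : (R1.toCpInt p).comp (PowerSeries.constantCoeff : IwasawaAlgebra p →+* ℤ_[p]) =
      (PowerSeries.constantCoeff : PowerSeries 𝓞_ℂ_[p] →+* 𝓞_ℂ_[p]).comp (PowerSeries.map (R1.toCpInt p)) := by
    ext g
    simp [hcc]
  rw [hcomp, ← Ideal.map_map]
  refine (Ideal.map_mono hflat).trans ?_
  rw [Ideal.map_span, Set.image_singleton]

end Summit.BirchSwinnertonDyer.BirchSwinnertonDyer.Theorems.BiquadraticEisensteinDescentEisensteinDivisibilityCMInertBadFlatAtOneOfFacts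

end
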